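import Summits.Parity.GeneralizedHardyLittlewood.Theorems.BeyondDiagonalBeatsQuarter.OffDiagCoreWinIntegrable
import HarnessLib

/-!
# Route `PrimeLevelFamEdge`, crux K_B (stmt-Parity-20343), line `diagonal_kernel_split` rev 4, plan Ω,
# node **L7d part 2, leaf G2b — a finite member sum passes under the unit-box integral** (L7D-PLAN rev 7 §7 G2;
# consumer of F0 `integrable_unitBox_levelLargePart` / `integrable_integral_unitBox_levelLargePart`)

Abstract over the member index `ι` with data maps `(r, l, m, d₁, d₂, i, h₁, s) : ι → …` (`l, m ≥ 1`, `d₁ ∣ l`, `d₂ ∣ m` on the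
family), moduli/classes `md, cl`, a block `Q` of levels `q ≠ 0`, a universal level weight `g` and member scalars `c x`:

  `Σ_{x∈fam} c_x · ∫dτ₁∫dτ₂ Kern_x(τ)·levelLargePart R Q (g·Ψ_τ(x;1/·)) (md x) (cl x)
     = ∫dτ₁∫dτ₂ Σ_{x∈fam} c_x·Kern_x(τ)·levelLargePart R Q (g·Ψ_τ(x;1/·)) (md x) (cl x)`

(**`sum_mul_integral_unitBox_eq_integral_sum`**): `integral_finsetSum` twice, each member integrand integrable by F0.

Helper; standard axioms; closes nothing. «The programme SEARCHES and TYPES; no claim about Landau–Siegel zeros,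
Theorems 1–2 of arXiv:2211.02515 or a repaired Margin232 until a kernel theorem says so.»
-/

noncomputable section

open Finset Real Complex MeasureTheory
open scoped Nat

namespace Summit.Parity.GeneralizedHardyLittlewood.Theorems.BeyondDiagonalBeatsQuarter.OffDiag

open Literature.Analysis.FunctionSpaces (besselJ)
open Literature.Analysis.Calculus.WhitneyConvex (dyadicBump)
open Literature.NumberTheory.LFunctions.KMV2000 (cutoffW)
open Literature.NumberTheory.Sieve.FriedlanderIwaniecPrimes (fourier2 ker)

/-- **A finite member sum passes under the unit-box integral.** See the module docstring.
[cite: KowalskiMichelVanderKam2000, §6 p. 19 — derivation] -/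
theorem sum_mul_integral_unitBox_eq_integral_sum {ι : Type*} (fam : Finset ι) (r l m d₁ d₂ : ι → ℕ) (i : ι → ℕ × ℕ)
    (h₁ s : ι → ℤ) (hl : ∀ x ∈ fam, 1 ≤ l x) (hm : ∀ x ∈ fam, 1 ≤ m x) (hd₁ : ∀ x ∈ fam, d₁ x ∣ l x)
    (hd₂ : ∀ x ∈ fam, d₂ x ∣ m x) (R : ℕ) (Q : Finset ℕ) (hQ : ∀ q ∈ Q, q ≠ 0) (g : ℕ → ℂ)
    (md : ι → ℕ) (cl : (x : ι) → ZMod (md x)) (c : ι → ℂ) :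
    ∑ x ∈ fam, c x * ∫ τ₁, ∫ τ₂, (((dyadicBump τ₁ * dyadicBump τ₂ *
            (((d₁ x : ℝ) * (2 ^ (i x).1 * τ₁) * ((d₂ x : ℝ) * (2 ^ (i x).2 * τ₂))) ^ (-(1 / 2 : ℝ)) *
              (((r x + 1 : ℕ) : ℝ))⁻¹) : ℝ) : ℂ) * ker (2 ^ (i x).2 * τ₂) ((s x : ℝ) / h₁ x)) *
          levelLargePart R Q (fun q ↦ g q *
            (((cutoffW ((4 * π ^ 2 * ((d₁ x : ℝ) * (2 ^ (i x).1 * τ₁) * ((d₂ x : ℝ) * (2 ^ (i x).2 * τ₂)))) *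
                ((q : ℝ))⁻¹) : ℝ) : ℂ) *
              ((besselJ 1 ((4 * π * Real.sqrt (((l x / d₁ x : ℕ) : ℝ) * (2 ^ (i x).1 * τ₁) *
                  (((m x / d₂ x : ℕ) : ℝ) * (2 ^ (i x).2 * τ₂))) / ((r x + 1 : ℕ) : ℝ)) * ((q : ℝ))⁻¹) : ℝ) : ℂ) *
                Complex.exp (((-2 * π * ((2 ^ (i x).1 * τ₁) * ((h₁ x : ℝ) / (r x + 1)) +
                    (2 ^ (i x).2 * τ₂) * ((((l x / d₁ x : ℕ) : ℤ) * (m x / d₂ x : ℕ) : ℝ) / ((h₁ x : ℝ) * (r x + 1)))) *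
                  ((q : ℝ))⁻¹ : ℝ) : ℂ) * I))) (md x) (cl x) =
      ∫ τ₁, ∫ τ₂, ∑ x ∈ fam, c x * ((((dyadicBump τ₁ * dyadicBump τ₂ *
            (((d₁ x : ℝ) * (2 ^ (i x).1 * τ₁) * ((d₂ x : ℝ) * (2 ^ (i x).2 * τ₂))) ^ (-(1 / 2 : ℝ)) *
              (((r x + 1 : ℕ) : ℝ))⁻¹) : ℝ) : ℂ) * ker (2 ^ (i x).2 * τ₂) ((s x : ℝ) / h₁ x)) *
          levelLargePart R Q (fun q ↦ g q *
            (((cutoffW ((4 * π ^ 2 * ((d₁ x : ℝ) * (2 ^ (i x).1 * τ₁) * ((d₂ x : ℝ) * (2 ^ (i x).2 * τ₂)))) *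
                ((q : ℝ))⁻¹) : ℝ) : ℂ) *
              ((besselJ 1 ((4 * π * Real.sqrt (((l x / d₁ x : ℕ) : ℝ) * (2 ^ (i x).1 * τ₁) *
                  (((m x / d₂ x : ℕ) : ℝ) * (2 ^ (i x).2 * τ₂))) / ((r x + 1 : ℕ) : ℝ)) * ((q : ℝ))⁻¹) : ℝ) : ℂ) *
                Complex.exp (((-2 * π * ((2 ^ (i x).1 * τ₁) * ((h₁ x : ℝ) / (r x + 1)) +
                    (2 ^ (i x).2 * τ₂) * ((((l x / d₁ x : ℕ) : ℤ) * (m x / d₂ x : ℕ) : ℝ) / ((h₁ x : ℝ) * (r x + 1)))) *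
                  ((q : ℝ))⁻¹ : ℝ) : ℂ) * I))) (md x) (cl x)) := by
  -- integrability of every member's integrand, both layers (F0)
  have hin : ∀ x ∈ fam, ∀ τ₁ : ℝ, Integrable (fun τ₂ : ℝ ↦ c x * ((((dyadicBump τ₁ * dyadicBump τ₂ *
            (((d₁ x : ℝ) * (2 ^ (i x).1 * τ₁) * ((d₂ x : ℝ) * (2 ^ (i x).2 * τ₂))) ^ (-(1 / 2 : ℝ)) *
              (((r x + 1 : ℕ) : ℝ))⁻¹) : ℝ) : ℂ) * ker (2 ^ (i x).2 * τ₂) ((s x : ℝ) / h₁ x)) *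
          levelLargePart R Q (fun q ↦ g q *
            (((cutoffW ((4 * π ^ 2 * ((d₁ x : ℝ) * (2 ^ (i x).1 * τ₁) * ((d₂ x : ℝ) * (2 ^ (i x).2 * τ₂)))) *
                ((q : ℝ))⁻¹) : ℝ) : ℂ) *
              ((besselJ 1 ((4 * π * Real.sqrt (((l x / d₁ x : ℕ) : ℝ) * (2 ^ (i x).1 * τ₁) *
                  (((m x / d₂ x : ℕ) : ℝ) * (2 ^ (i x).2 * τ₂))) / ((r x + 1 : ℕ) : ℝ)) * ((q : ℝ))⁻¹) : ℝ) : ℂ) *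
                Complex.exp (((-2 * π * ((2 ^ (i x).1 * τ₁) * ((h₁ x : ℝ) / (r x + 1)) +
                    (2 ^ (i x).2 * τ₂) * ((((l x / d₁ x : ℕ) : ℤ) * (m x / d₂ x : ℕ) : ℝ) / ((h₁ x : ℝ) * (r x + 1)))) *
                  ((q : ℝ))⁻¹ : ℝ) : ℂ) * I))) (md x) (cl x))) := fun x hx τ₁ ↦
    (integrable_unitBox_levelLargePart (hl x hx) (hm x hx) (hd₁ x hx) (hd₂ x hx) (r x) (i x) (h₁ x) (s x) R Q hQ g
      (cl x) τ₁).const_mul (c x)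
  have hout : ∀ x ∈ fam, Integrable (fun τ₁ : ℝ ↦ ∫ τ₂, c x * ((((dyadicBump τ₁ * dyadicBump τ₂ *
            (((d₁ x : ℝ) * (2 ^ (i x).1 * τ₁) * ((d₂ x : ℝ) * (2 ^ (i x).2 * τ₂))) ^ (-(1 / 2 : ℝ)) *
              (((r x + 1 : ℕ) : ℝ))⁻¹) : ℝ) : ℂ) * ker (2 ^ (i x).2 * τ₂) ((s x : ℝ) / h₁ x)) *
          levelLargePart R Q (fun q ↦ g q *
            (((cutoffW ((4 * π ^ 2 * ((d₁ x : ℝ) * (2 ^ (i x).1 * τ₁) * ((d₂ x : ℝ) * (2 ^ (i x).2 * τ₂)))) *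
                ((q : ℝ))⁻¹) : ℝ) : ℂ) *
              ((besselJ 1 ((4 * π * Real.sqrt (((l x / d₁ x : ℕ) : ℝ) * (2 ^ (i x).1 * τ₁) *
                  (((m x / d₂ x : ℕ) : ℝ) * (2 ^ (i x).2 * τ₂))) / ((r x + 1 : ℕ) : ℝ)) * ((q : ℝ))⁻¹) : ℝ) : ℂ) *
                Complex.exp (((-2 * π * ((2 ^ (i x).1 * τ₁) * ((h₁ x : ℝ) / (r x + 1)) +
                    (2 ^ (i x).2 * τ₂) * ((((l x / d₁ x : ℕ) : ℤ) * (m x / d₂ x : ℕ) : ℝ) / ((h₁ x : ℝ) * (r x + 1)))) *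
                  ((q : ℝ))⁻¹ : ℝ) : ℂ) * I))) (md x) (cl x))) := by
    intro x hx
    have h := (integrable_integral_unitBox_levelLargePart (hl x hx) (hm x hx) (hd₁ x hx) (hd₂ x hx) (r x) (i x)
      (h₁ x) (s x) R Q hQ g (cl x)).const_mul (c x)
    refine h.congr (Filter.Eventually.of_forall fun τ₁ ↦ ?_)
    dsimp only
    rw [← integral_const_mul]
  -- each member: scalar inside both integrals
  have hmem : ∀ x ∈ fam, c x * ∫ τ₁, ∫ τ₂, ((((dyadicBump τ₁ * dyadicBump τ₂ *
            (((d₁ x : ℝ) * (2 ^ (i x).1 * τ₁) * ((d₂ x : ℝ) * (2 ^ (i x).2 * τ₂))) ^ (-(1 / 2 : ℝ)) *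
              (((r x + 1 : ℕ) : ℝ))⁻¹) : ℝ) : ℂ) * ker (2 ^ (i x).2 * τ₂) ((s x : ℝ) / h₁ x)) *
          levelLargePart R Q (fun q ↦ g q *
            (((cutoffW ((4 * π ^ 2 * ((d₁ x : ℝ) * (2 ^ (i x).1 * τ₁) * ((d₂ x : ℝ) * (2 ^ (i x).2 * τ₂)))) *
                ((q : ℝ))⁻¹) : ℝ) : ℂ) *
              ((besselJ 1 ((4 * π * Real.sqrt (((l x / d₁ x : ℕ) : ℝ) * (2 ^ (i x).1 * τ₁) *
                  (((m x / d₂ x : ℕ) : ℝ) * (2 ^ (i x).2 * τ₂))) / ((r x + 1 : ℕ) : ℝ)) * ((q : ℝ))⁻¹) : ℝ) : ℂ) *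
                Complex.exp (((-2 * π * ((2 ^ (i x).1 * τ₁) * ((h₁ x : ℝ) / (r x + 1)) +
                    (2 ^ (i x).2 * τ₂) * ((((l x / d₁ x : ℕ) : ℤ) * (m x / d₂ x : ℕ) : ℝ) / ((h₁ x : ℝ) * (r x + 1)))) *
                  ((q : ℝ))⁻¹ : ℝ) : ℂ) * I))) (md x) (cl x)) =
      ∫ τ₁, ∫ τ₂, c x * ((((dyadicBump τ₁ * dyadicBump τ₂ *
            (((d₁ x : ℝ) * (2 ^ (i x).1 * τ₁) * ((d₂ x : ℝ) * (2 ^ (i x).2 * τ₂))) ^ (-(1 / 2 : ℝ)) *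
              (((r x + 1 : ℕ) : ℝ))⁻¹) : ℝ) : ℂ) * ker (2 ^ (i x).2 * τ₂) ((s x : ℝ) / h₁ x)) *
          levelLargePart R Q (fun q ↦ g q *
            (((cutoffW ((4 * π ^ 2 * ((d₁ x : ℝ) * (2 ^ (i x).1 * τ₁) * ((d₂ x : ℝ) * (2 ^ (i x).2 * τ₂)))) *
                ((q : ℝ))⁻¹) : ℝ) : ℂ) *
              ((besselJ 1 ((4 * π * Real.sqrt (((l x / d₁ x : ℕ) : ℝ) * (2 ^ (i x).1 * τ₁) *
                  (((m x / d₂ x : ℕ) : ℝ) * (2 ^ (i x).2 * τ₂))) / ((r x + 1 : ℕ) : ℝ)) * ((q : ℝ))⁻¹) : ℝ) : ℂ) *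
                Complex.exp (((-2 * π * ((2 ^ (i x).1 * τ₁) * ((h₁ x : ℝ) / (r x + 1)) +
                    (2 ^ (i x).2 * τ₂) * ((((l x / d₁ x : ℕ) : ℤ) * (m x / d₂ x : ℕ) : ℝ) / ((h₁ x : ℝ) * (r x + 1)))) *
                  ((q : ℝ))⁻¹ : ℝ) : ℂ) * I))) (md x) (cl x)) := by
    intro x _
    rw [← integral_const_mul]
    refine integral_congr_ae (Filter.Eventually.of_forall fun τ₁ ↦ ?_)
    dsimp only
    rw [← integral_const_mul]
  rw [Finset.sum_congr rfl hmem, ← integral_finsetSum _ hout]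
  refine integral_congr_ae (Filter.Eventually.of_forall fun τ₁ ↦ ?_)
  dsimp only
  rw [← integral_finsetSum _ (fun x hx ↦ hin x hx τ₁)]

end Summit.Parity.GeneralizedHardyLittlewood.Theorems.BeyondDiagonalBeatsQuarter.OffDiag
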